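import Mathlib

/-!
# T5SplitUnitary — the split-place dictionary `U(V_v) ≅ GL_n(F_v)` (Tier-5 §G row B2, N3 / N4)

At a place `v` of `F⁺` that SPLITS in `E` one has `E_v = F_v × F_v` with the conjugation
swapping the two factors, and the record's rows use the standard dictionary «the pair
`(U(W₁₂,v), U(V_v))` is `(GL₂(F_v), GL₃(F_v))`» (route/T5-route-3.md row B2, l. 24:
«[A: split dictionary, standard]»).  This file is the kernel witness of that dictionary in the
matrix model:

* `SplitAlg F = F × F` with the swap involution is a commutative `StarRing`
  (`instStarRingSplitAlg`); a matrix `g` over it has two components `fst g`, `snd g` over `F`,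
  and `star g = gᴴ` has components `(snd g)ᵀ`, `(fst g)ᵀ` (`fst_star`, `snd_star`);
* `mem_unitaryGroup_iff`: `g ∈ U_n(F × F)` (Mathlib's `Matrix.unitaryGroup n (SplitAlg F)`,
  the unitary group of the standard hermitian form) iff `fst g · (snd g)ᵀ = 1`;
* **`unitaryGroupEquivGL : Matrix.unitaryGroup n (SplitAlg F) ≃* GL n F`**, `g ↦ fst g`, with
  inverse `A ↦ (A, (A⁻¹)ᵀ)` (`toGL`, `ofGL`);
* `isHermitian_iff` / `exists_star_mul`: a hermitian matrix over `F × F` is exactly `(A, Aᵀ)`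
  and is always `Pᴴ P` (every hermitian form over the split algebra is in the class of the
  standard one; `P = (1, Aᵀ)`, invertible iff `A` is);
* `isUnitaryFor_iff_mem_unitaryGroup`: for `H = Pᴴ P` with `P` invertible, `g` preserves `H`
  iff `P g P⁻¹ ∈ U_n(F × F)` — so `U(H) ≅ U_n(F × F) ≅ GL_n(F)` for every non-degenerate
  hermitian form over the split algebra.

What stays prose: that `E_v = F_v × F_v` at a split place with the conjugation swapping the
factors, and that the Weil representation restricted to the split pair is the type-II Weil
representation twisted by the splitting characters (the rest of the row's [A]).  No Literature
fact is asserted.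
-/

namespace Summit.Ventures.HodgeRepro2.T5SplitUnitary

/-- The split quadratic algebra `F × F`, carrying the swap involution as its `star`. -/
def SplitAlg (F : Type*) := F × F

variable {F : Type*}

/-- The swap involution `(a, b) ↦ (b, a)`. -/
instance instStarSplitAlg : Star (SplitAlg F) := ⟨fun x => ((x : F × F).2, (x : F × F).1)⟩

/-- The first component of an element of `F × F`. -/
def c1 (x : SplitAlg F) : F := (x : F × F).1

/-- The second component of an element of `F × F`. -/
def c2 (x : SplitAlg F) : F := (x : F × F).2

/-- The element `(a, b)`. -/
def mk (a b : F) : SplitAlg F := ((a, b) : F × F)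

/-- First component of `star`. -/
@[simp] theorem c1_star (x : SplitAlg F) : c1 (star x) = c2 x := rfl

/-- Second component of `star`. -/
@[simp] theorem c2_star (x : SplitAlg F) : c2 (star x) = c1 x := rfl

/-- Components of `mk`. -/
@[simp] theorem c1_mk (a b : F) : c1 (mk a b) = a := rfl

/-- Components of `mk`. -/
@[simp] theorem c2_mk (a b : F) : c2 (mk a b) = b := rfl

/-- Two elements with the same components are equal. -/
theorem ext_c {x y : SplitAlg F} (h1 : c1 x = c1 y) (h2 : c2 x = c2 y) : x = y :=
  Prod.ext h1 h2

/-- The swap is an involution. -/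
instance instInvolutiveStarSplitAlg : InvolutiveStar (SplitAlg F) :=
  ⟨fun _ => ext_c rfl rfl⟩

/-- `star` is the swap. -/
theorem star_eq_mk (x : SplitAlg F) : star x = mk (c2 x) (c1 x) := rfl

variable [Field F]

/-- The product ring structure of `F × F`. -/
instance instCommRingSplitAlg : CommRing (SplitAlg F) := inferInstanceAs (CommRing (F × F))

/-- Components of a product. -/
@[simp] theorem c1_mul (x y : SplitAlg F) : c1 (x * y) = c1 x * c1 y := rfl

/-- Components of a product. -/
@[simp] theorem c2_mul (x y : SplitAlg F) : c2 (x * y) = c2 x * c2 y := rfl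

/-- Components of a sum. -/
@[simp] theorem c1_add (x y : SplitAlg F) : c1 (x + y) = c1 x + c1 y := rfl

/-- Components of a sum. -/
@[simp] theorem c2_add (x y : SplitAlg F) : c2 (x + y) = c2 x + c2 y := rfl

/-- Components of `0`. -/
@[simp] theorem c1_zero : c1 (0 : SplitAlg F) = 0 := rfl

/-- Components of `0`. -/
@[simp] theorem c2_zero : c2 (0 : SplitAlg F) = 0 := rfl

/-- Components of `1`. -/
@[simp] theorem c1_one : c1 (1 : SplitAlg F) = 1 := rfl

/-- Components of `1`. -/
@[simp] theorem c2_one : c2 (1 : SplitAlg F) = 1 := rfl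

/-- The swap is multiplicative (an anti-automorphism = automorphism, the ring being commutative). -/
instance instStarMulSplitAlg : StarMul (SplitAlg F) :=
  ⟨fun x y => ext_c (by simp [mul_comm]) (by simp [mul_comm])⟩

/-- The swap involution makes `F × F` a commutative `StarRing`. -/
instance instStarRingSplitAlg : StarRing (SplitAlg F) :=
  ⟨fun _ _ => ext_c rfl rfl⟩

/-- The first component as an additive map. -/
def c1Hom : SplitAlg F →+ F where
  toFun := c1
  map_zero' := rfl
  map_add' := fun _ _ => rfl

/-- The second component as an additive map. -/
def c2Hom : SplitAlg F →+ F where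
  toFun := c2
  map_zero' := rfl
  map_add' := fun _ _ => rfl

/-- The norm `x · star x` is `(a b, a b)`: the split algebra's norm form is the product of the
two components. -/
theorem mul_star_eq (x : SplitAlg F) : x * star x = mk (c1 x * c2 x) (c1 x * c2 x) :=
  ext_c (by simp) (by simp [mul_comm])

/-! ## Matrices over the split algebra -/

section Matrices

open scoped Matrix

variable {n : Type*}

/-- The first component of a matrix over `F × F`. -/
def fst (g : Matrix n n (SplitAlg F)) : Matrix n n F := fun i j => c1 (g i j)

/-- The second component of a matrix over `F × F`. -/
def snd (g : Matrix n n (SplitAlg F)) : Matrix n n F := fun i j => c2 (g i j)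

/-- The matrix with components `A`, `B`. -/
def pair (A B : Matrix n n F) : Matrix n n (SplitAlg F) := fun i j => mk (A i j) (B i j)

omit [Field F] in
/-- `fst` of `pair`. -/
@[simp] theorem fst_pair (A B : Matrix n n F) : fst (pair A B) = A := rfl

omit [Field F] in
/-- `snd` of `pair`. -/
@[simp] theorem snd_pair (A B : Matrix n n F) : snd (pair A B) = B := rfl

omit [Field F] in
/-- A matrix over `F × F` is the pair of its components. -/
theorem pair_fst_snd (g : Matrix n n (SplitAlg F)) : pair (fst g) (snd g) = g := by
  funext i j
  exact ext_c rfl rfl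

omit [Field F] in
/-- Matrices with the same components are equal. -/
theorem ext_fst_snd {g h : Matrix n n (SplitAlg F)} (h1 : fst g = fst h) (h2 : snd g = snd h) :
    g = h := by
  rw [← pair_fst_snd g, ← pair_fst_snd h, h1, h2]

omit [Field F] in
/-- The first component of `star g = gᴴ` is the transpose of the second component of `g`. -/
theorem fst_star (g : Matrix n n (SplitAlg F)) : fst (star g) = (snd g).transpose := by
  funext i j
  rfl

omit [Field F] in
/-- The second component of `star g = gᴴ` is the transpose of the first component of `g`. -/
theorem snd_star (g : Matrix n n (SplitAlg F)) : snd (star g) = (fst g).transpose := by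
  funext i j
  rfl

omit [Field F] in
/-- `star (pair A B) = pair Bᵀ Aᵀ`. -/
theorem star_pair (A B : Matrix n n F) : star (pair A B) = pair B.transpose A.transpose := by
  apply ext_fst_snd
  · rw [fst_star, snd_pair, fst_pair]
  · rw [snd_star, fst_pair, snd_pair]

variable [Fintype n] [DecidableEq n]

omit [DecidableEq n] in
/-- `fst` is multiplicative. -/
theorem fst_mul (g h : Matrix n n (SplitAlg F)) : fst (g * h) = fst g * fst h := by
  funext i k
  simp only [fst, Matrix.mul_apply]
  exact (map_sum (c1Hom (F := F)) (fun j => g i j * h j k) Finset.univ).trans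
    (Finset.sum_congr rfl fun j _ => c1_mul _ _)

omit [DecidableEq n] in
/-- `snd` is multiplicative. -/
theorem snd_mul (g h : Matrix n n (SplitAlg F)) : snd (g * h) = snd g * snd h := by
  funext i k
  simp only [snd, Matrix.mul_apply]
  exact (map_sum (c2Hom (F := F)) (fun j => g i j * h j k) Finset.univ).trans
    (Finset.sum_congr rfl fun j _ => c2_mul _ _)

omit [Fintype n] in
/-- `fst 1 = 1`. -/
theorem fst_one : fst (1 : Matrix n n (SplitAlg F)) = 1 := by
  funext i j
  simp only [fst, Matrix.one_apply]
  split_ifs <;> rfl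

omit [Fintype n] in
/-- `snd 1 = 1`. -/
theorem snd_one : snd (1 : Matrix n n (SplitAlg F)) = 1 := by
  funext i j
  simp only [snd, Matrix.one_apply]
  split_ifs <;> rfl

omit [DecidableEq n] in
/-- `pair` is multiplicative componentwise. -/
theorem pair_mul (A B C D : Matrix n n F) : pair A B * pair C D = pair (A * C) (B * D) := by
  apply ext_fst_snd
  · rw [fst_mul, fst_pair, fst_pair, fst_pair]
  · rw [snd_mul, snd_pair, snd_pair, snd_pair]

omit [Fintype n] in
/-- `pair 1 1 = 1`. -/
theorem pair_one : pair (1 : Matrix n n F) 1 = 1 := by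
  apply ext_fst_snd
  · rw [fst_pair, fst_one]
  · rw [snd_pair, snd_one]

/-! ## The unitary group of the standard form is `GL_n(F)` -/

/-- **The split dictionary, membership form:** `g ∈ U_n(F × F)` iff `fst g · (snd g)ᵀ = 1`. -/
theorem mem_unitaryGroup_iff (g : Matrix n n (SplitAlg F)) :
    g ∈ Matrix.unitaryGroup n (SplitAlg F) ↔ fst g * (snd g).transpose = 1 := by
  rw [Matrix.mem_unitaryGroup_iff]
  constructor
  · intro h
    have := congrArg fst h
    rwa [fst_mul, fst_star, fst_one] at this
  · intro h
    apply ext_fst_snd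
    · rw [fst_mul, fst_star, fst_one, h]
    · rw [snd_mul, snd_star, snd_one]
      have := congrArg Matrix.transpose h
      rwa [Matrix.transpose_mul, Matrix.transpose_transpose, Matrix.transpose_one] at this

/-- `g ∈ U_n(F × F)` iff `(snd g)ᵀ · fst g = 1`. -/
theorem mem_unitaryGroup_iff' (g : Matrix n n (SplitAlg F)) :
    g ∈ Matrix.unitaryGroup n (SplitAlg F) ↔ (snd g).transpose * fst g = 1 := by
  rw [mem_unitaryGroup_iff, mul_eq_one_comm]

/-- `U_n(F × F) → GL_n(F)`, `g ↦ fst g` (the inverse of `fst g` is `(snd g)ᵀ`). -/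
def toGL (g : Matrix.unitaryGroup n (SplitAlg F)) : GL n F :=
  ⟨fst (g : Matrix n n (SplitAlg F)), (snd (g : Matrix n n (SplitAlg F))).transpose,
    (mem_unitaryGroup_iff _).mp g.2, (mem_unitaryGroup_iff' _).mp g.2⟩

/-- The underlying matrix of `toGL g` is `fst g`. -/
@[simp] theorem coe_toGL (g : Matrix.unitaryGroup n (SplitAlg F)) :
    (toGL g : Matrix n n F) = fst (g : Matrix n n (SplitAlg F)) := rfl

/-- The underlying matrix of `(toGL g)⁻¹` is `(snd g)ᵀ`. -/
@[simp] theorem coe_toGL_inv (g : Matrix.unitaryGroup n (SplitAlg F)) :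
    (((toGL g)⁻¹ : GL n F) : Matrix n n F) = (snd (g : Matrix n n (SplitAlg F))).transpose :=
  rfl

/-- `GL_n(F) → U_n(F × F)`, `A ↦ (A, (A⁻¹)ᵀ)`. -/
def ofGL (A : GL n F) : Matrix.unitaryGroup n (SplitAlg F) :=
  ⟨pair (A : Matrix n n F) ((A⁻¹ : GL n F) : Matrix n n F).transpose, by
    rw [mem_unitaryGroup_iff, fst_pair, snd_pair, Matrix.transpose_transpose]
    exact A.mul_inv⟩

/-- The underlying matrix of `ofGL A`. -/
@[simp] theorem coe_ofGL (A : GL n F) :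
    (ofGL A : Matrix n n (SplitAlg F)) =
      pair (A : Matrix n n F) ((A⁻¹ : GL n F) : Matrix n n F).transpose := rfl

/-- `toGL ∘ ofGL = id`. -/
theorem toGL_ofGL (A : GL n F) : toGL (ofGL A) = A := by
  apply Units.ext
  rw [coe_toGL, coe_ofGL, fst_pair]

/-- `ofGL ∘ toGL = id`. -/
theorem ofGL_toGL (g : Matrix.unitaryGroup n (SplitAlg F)) : ofGL (toGL g) = g := by
  apply Subtype.ext
  rw [coe_ofGL, coe_toGL, coe_toGL_inv, Matrix.transpose_transpose, pair_fst_snd]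

/-- `toGL` is multiplicative. -/
theorem toGL_mul (g h : Matrix.unitaryGroup n (SplitAlg F)) : toGL (g * h) = toGL g * toGL h := by
  apply Units.ext
  rw [Units.val_mul, coe_toGL, coe_toGL, coe_toGL, Submonoid.coe_mul, fst_mul]

/-- **The split dictionary:** `U_n(F × F) ≃* GL_n(F)`. -/
def unitaryGroupEquivGL : Matrix.unitaryGroup n (SplitAlg F) ≃* GL n F where
  toFun := toGL
  invFun := ofGL
  left_inv := ofGL_toGL
  right_inv := toGL_ofGL
  map_mul' := toGL_mul

/-- The isomorphism is `g ↦ fst g` on underlying matrices. -/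
@[simp] theorem coe_unitaryGroupEquivGL_apply (g : Matrix.unitaryGroup n (SplitAlg F)) :
    (unitaryGroupEquivGL g : Matrix n n F) = fst (g : Matrix n n (SplitAlg F)) := rfl

/-- …and its inverse is `A ↦ (A, (A⁻¹)ᵀ)`. -/
@[simp] theorem coe_unitaryGroupEquivGL_symm_apply (A : GL n F) :
    (unitaryGroupEquivGL.symm A : Matrix n n (SplitAlg F)) =
      pair (A : Matrix n n F) ((A⁻¹ : GL n F) : Matrix n n F).transpose := rfl

/-! ## Hermitian forms over the split algebra: a single class -/

omit [Field F] [Fintype n] [DecidableEq n] in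
/-- A matrix over `F × F` is hermitian (`Hᴴ = H`) iff its second component is the transpose of
its first: `H = (A, Aᵀ)`. -/
theorem isHermitian_iff (H : Matrix n n (SplitAlg F)) :
    star H = H ↔ snd H = (fst H).transpose := by
  constructor
  · intro h
    have := congrArg snd h
    rwa [snd_star, eq_comm] at this
  · intro h
    apply ext_fst_snd
    · rw [fst_star, h, Matrix.transpose_transpose]
    · rw [snd_star, h]

/-- Every hermitian matrix over the split algebra is `Pᴴ P` with `P = (1, Aᵀ)`, `A = fst H`. -/
theorem exists_star_mul (H : Matrix n n (SplitAlg F)) (hH : star H = H) :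
    ∃ P : Matrix n n (SplitAlg F), star P * P = H := by
  refine ⟨pair 1 (fst H).transpose, ?_⟩
  rw [star_pair, Matrix.transpose_transpose, Matrix.transpose_one, pair_mul, mul_one, one_mul,
    ← (isHermitian_iff H).mp hH, pair_fst_snd]

/-- `g` preserves the hermitian form `H`: `gᴴ H g = H`. -/
def IsUnitaryFor (H g : Matrix n n (SplitAlg F)) : Prop := star g * H * g = H

/-- For `H = Pᴴ P` with `P` invertible, `g` preserves `H` iff `P g P⁻¹` is in the unitary group
of the standard form: `U(H) ≅ U_n(F × F)`. -/
theorem isUnitaryFor_iff_mem_unitaryGroup (P g : Matrix n n (SplitAlg F)) (hP : IsUnit P.det) :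
    IsUnitaryFor (star P * P) g ↔ P * g * P⁻¹ ∈ Matrix.unitaryGroup n (SplitAlg F) := by
  have hPs : IsUnit (star P).det := by
    rw [Matrix.star_eq_conjTranspose, Matrix.det_conjTranspose]
    exact hP.star
  rw [Matrix.mem_unitaryGroup_iff', IsUnitaryFor]
  simp only [Matrix.star_eq_conjTranspose] at hPs ⊢
  rw [Matrix.conjTranspose_mul, Matrix.conjTranspose_mul, Matrix.conjTranspose_nonsing_inv]
  constructor
  · intro h
    have e : Pᴴ⁻¹ * (gᴴ * Pᴴ) * (P * g * P⁻¹) = Pᴴ⁻¹ * (gᴴ * (Pᴴ * P) * g) * P⁻¹ := by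
      simp only [Matrix.mul_assoc]
    rw [e, h, ← Matrix.mul_assoc, Matrix.nonsing_inv_mul _ hPs, Matrix.one_mul,
      Matrix.mul_nonsing_inv _ hP]
  · intro h
    have h2 : Pᴴ * (Pᴴ⁻¹ * (gᴴ * Pᴴ) * (P * g * P⁻¹)) * P = Pᴴ * P := by
      rw [h, Matrix.mul_one]
    have h3 : Pᴴ * (Pᴴ⁻¹ * (gᴴ * Pᴴ) * (P * g * P⁻¹)) * P = gᴴ * (Pᴴ * P) * g := by
      calc Pᴴ * (Pᴴ⁻¹ * (gᴴ * Pᴴ) * (P * g * P⁻¹)) * P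
          = (Pᴴ * Pᴴ⁻¹) * (gᴴ * (Pᴴ * P) * g) * (P⁻¹ * P) := by simp only [Matrix.mul_assoc]
        _ = gᴴ * (Pᴴ * P) * g := by
          rw [Matrix.mul_nonsing_inv _ hPs, Matrix.nonsing_inv_mul _ hP, Matrix.one_mul,
            Matrix.mul_one]
    rw [← h3, h2]

end Matrices

end Summit.Ventures.HodgeRepro2.T5SplitUnitary
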